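import Summits.AtomisticToContinuum.HydrodynamicLimit.Theorems.AntiMazurCoboundariesKineticFluxLdDecayHTheoremObjectsB
import Summits.AtomisticToContinuum.HydrodynamicLimit.Theorems.AntiMazurCoboundariesKineticFluxLdDecayGainDomination
import HarnessLib

/-!
# `GainDomination → GainDominationLocal` by restriction–renormalisation
# (line `h-theorem-dissipation-budget`, crux `KineticFluxLdDecay`, stmt-AtomisticToContinuum-10967; lead a2)

The localised kinetic lemma of the reshaped skeleton follows from the global one applied to the one-body law
conditioned on the fibres `E × ℝ³`: `f' = f(· | E × ℝ³)`. Three facts: the gain on `E` is `f(E×ℝ³) ×` the gain of `f'`;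
the Hellinger production is a functional of the a.e. class of the density and 2-homogeneous, so the production of `f'` is
`f(E×ℝ³)⁻² ×` the production of the density cut to `E`; and the velocity relative entropy of the conditioned law is at
most `f(E×ℝ³)⁻¹ ×` that of `f` (the log-likelihood ratio against `f₁ ⊗ γ` is unchanged by conditioning on a set of
fibres, and its integral over the complementary fibres is a Gibbs-nonnegative equal-mass divergence).
-/

noncomputable section

open MeasureTheory ProbabilityTheory Set Filter InformationTheory
open scoped ENNReal NNReal

namespace Summit.AtomisticToContinuum.HydrodynamicLimit.Theorems.HTheorem

open Literature.MathematicalPhysics.KineticTheory (T3 V3 collide sphereMeasure)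
open Literature.Analysis.UnboundedOperators (collisionDensity
  quasiMeasurePreserving_fst_fst quasiMeasurePreserving_fst_snd quasiMeasurePreserving_collide_fst
  quasiMeasurePreserving_collide_snd volume_absolutelyContinuous_stdGaussian)

namespace Localise

/-! ## The production functional: homogeneity and a.e.-invariance -/

/-- The Hellinger defect is 1-homogeneous under nonnegative scaling of the density. -/
theorem hellingerDefect_const_mul {c : ℝ} (hc : 0 ≤ c) (r : V3 → ℝ) (q : CollSpace) :
    hellingerDefect (fun w => c * r w) q = c * hellingerDefect r q := by
  simp only [hellingerDefect, Real.sqrt_mul hc]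
  ring_nf
  rw [Real.sq_sqrt hc]
  ring

/-- 2-homogeneity of the production: `production (c ρ) = c² · production ρ` for `c ≥ 0`. -/
theorem production_const_mul {c : ℝ} (hc : 0 ≤ c) (ρ : T3 × V3 → ℝ) :
    production (fun y => c * ρ y) = ENNReal.ofReal (c ^ 2) * production ρ := by
  unfold production
  have hpt : ∀ (x : T3) (q : CollSpace),
      ENNReal.ofReal (collisionDensity q * hellingerDefect (fun w => c * ρ (x, w)) q ^ 2) =
        ENNReal.ofReal (c ^ 2) *
          ENNReal.ofReal (collisionDensity q * hellingerDefect (fun w => ρ (x, w)) q ^ 2) := by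
    intro x q
    rw [hellingerDefect_const_mul hc (fun w => ρ (x, w)) q, ← ENNReal.ofReal_mul (sq_nonneg c)]
    congr 1
    ring
  simp_rw [hpt]
  rw [← lintegral_const_mul' _ _ ENNReal.ofReal_ne_top]
  refine lintegral_congr fun x => ?_
  rw [lintegral_const_mul' _ _ ENNReal.ofReal_ne_top]

/-- The production is a functional of the `vol ⊗ γ`-a.e. class of the density. -/
theorem production_congr_ae {ρ ρ' : T3 × V3 → ℝ} (h : ρ =ᵐ[refMeasure] ρ') : production ρ = production ρ' := by
  unfold production
  refine lintegral_congr_ae ?_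
  have hx : ∀ᵐ x ∂(volume : Measure T3), ∀ᵐ w ∂(stdGaussian V3), ρ (x, w) = ρ' (x, w) :=
    Measure.ae_ae_of_ae_prod (μ := (volume : Measure T3)) (ν := stdGaussian V3) h
  filter_upwards [hx] with x hxw
  have hvol : ∀ᵐ w ∂(volume : Measure V3), ρ (x, w) = ρ' (x, w) :=
    volume_absolutelyContinuous_stdGaussian.ae_le hxw
  have h1 : ∀ᵐ q ∂collMeasure, ρ (x, q.1.1) = ρ' (x, q.1.1) :=
    (quasiMeasurePreserving_fst_fst (E := V3)).ae hvol
  have h2 : ∀ᵐ q ∂collMeasure, ρ (x, q.1.2) = ρ' (x, q.1.2) :=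
    (quasiMeasurePreserving_fst_snd (E := V3)).ae hvol
  have h3 : ∀ᵐ q ∂collMeasure, ρ (x, (collide q.2 q.1).1) = ρ' (x, (collide q.2 q.1).1) :=
    (quasiMeasurePreserving_collide_fst (E := V3)).ae hvol
  have h4 : ∀ᵐ q ∂collMeasure, ρ (x, (collide q.2 q.1).2) = ρ' (x, (collide q.2 q.1).2) :=
    (quasiMeasurePreserving_collide_snd (E := V3)).ae hvol
  refine lintegral_congr_ae ?_
  filter_upwards [h1, h2, h3, h4] with q hq1 hq2 hq3 hq4
  simp only [hellingerDefect, hq1, hq2, hq3, hq4]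

/-! ## Conditioning a one-body law on a set of fibres -/

section Condition

variable {f : Measure (T3 × V3)} {E : Set T3}

/-- `ℝ≥0`- and `ℝ≥0∞`-scalar multiples of a measure agree. -/
theorem nnreal_smul_eq_coe_smul {α : Type*} [MeasurableSpace α] (c : ℝ≥0) (ρ : Measure α) :
    c • ρ = (c : ℝ≥0∞) • ρ := by
  ext s _
  simp only [Measure.smul_apply, ENNReal.smul_def, smul_eq_mul]

/-- The position marginal of the restriction to the fibres over `E` is the restriction of the position marginal. -/
theorem fst_restrict_prod_univ (f : Measure (T3 × V3)) (hE : MeasurableSet E) :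
    (f.restrict (E ×ˢ (Set.univ : Set V3))).fst = f.fst.restrict E := by
  ext A hA
  rw [Measure.fst_apply hA, Measure.restrict_apply (measurable_fst hA), Measure.restrict_apply hA,
    Measure.fst_apply (hA.inter hE)]
  congr 1
  ext y
  simp only [Set.mem_inter_iff, Set.mem_preimage, Set.mem_prod, Set.mem_univ, and_true]

/-- The reference `f₁ ⊗ γ` of the restricted law is the restricted reference. -/
theorem fst_prod_restrict (f : Measure (T3 × V3)) [IsFiniteMeasure f] (hE : MeasurableSet E) :
    (f.restrict (E ×ˢ (Set.univ : Set V3))).fst.prod (stdGaussian V3) =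
      (f.fst.prod (stdGaussian V3)).restrict (E ×ˢ Set.univ) := by
  rw [fst_restrict_prod_univ f hE, Measure.restrict_prod_eq_prod_univ]

/-- Mass of the restricted reference: `((f|_S)₁ ⊗ γ)(univ) = f(S)` for `S = E × ℝ³`. -/
theorem fst_prod_restrict_univ (f : Measure (T3 × V3)) [IsFiniteMeasure f] (E : Set T3) :
    ((f.restrict (E ×ˢ (Set.univ : Set V3))).fst.prod (stdGaussian V3)) Set.univ = f (E ×ˢ Set.univ) := by
  rw [← Set.univ_prod_univ, Measure.prod_prod, Measure.fst_univ, Measure.restrict_apply_univ, measure_univ,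
    mul_one]

/-- The log-likelihood ratio against a reference is unchanged by restricting both to a measurable set. -/
theorem llr_restrict_ae_eq (f : Measure (T3 × V3)) [IsFiniteMeasure f] {S : Set (T3 × V3)}
    (hS : MeasurableSet S) {μ : Measure (T3 × V3)} [SigmaFinite μ] (hfμ : f ≪ μ) :
    llr (f.restrict S) (μ.restrict S) =ᵐ[μ.restrict S] llr f μ := by
  have hrn : (f.restrict S).rnDeriv (μ.restrict S) =ᵐ[μ.restrict S] f.rnDeriv μ := by
    have h1 : f.restrict S = (μ.restrict S).withDensity (f.rnDeriv μ) := by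
      rw [← restrict_withDensity hS, Measure.withDensity_rnDeriv_eq _ _ hfμ]
    rw [h1]
    exact Measure.rnDeriv_withDensity _ (Measure.measurable_rnDeriv f μ)
  filter_upwards [hrn] with y hy
  simp only [llr, hy]

variable [IsProbabilityMeasure f]

/-- **Gibbs on a set of fibres**: the integral of the log-likelihood ratio against `f₁ ⊗ γ` over a measurable set of
fibres is nonnegative (the two restricted measures have equal mass). -/
theorem setIntegral_llr_nonneg (hE : MeasurableSet E) (hvk : velKL f ≠ ⊤) :
    0 ≤ ∫ y in E ×ˢ Set.univ, llr f (f.fst.prod (stdGaussian V3)) y ∂f := by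
  have hS : MeasurableSet (E ×ˢ (Set.univ : Set V3)) := hE.prod MeasurableSet.univ
  obtain ⟨hac, hint⟩ := klDiv_ne_top_iff.1 hvk
  have hac' : f.restrict (E ×ˢ Set.univ) ≪ (f.fst.prod (stdGaussian V3)).restrict (E ×ˢ Set.univ) :=
    hac.restrict _
  have hllr := llr_restrict_ae_eq f hS hac
  have hint' : Integrable (llr (f.restrict (E ×ˢ Set.univ))
      ((f.fst.prod (stdGaussian V3)).restrict (E ×ˢ Set.univ))) (f.restrict (E ×ˢ Set.univ)) :=
    (integrable_congr (hac'.ae_le hllr)).2 hint.integrableOn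
  have h := integral_llr_add_sub_measure_univ_nonneg hac' hint'
  have hmass : ((f.fst.prod (stdGaussian V3)).restrict (E ×ˢ Set.univ)).real Set.univ =
      (f.restrict (E ×ˢ Set.univ)).real Set.univ := by
    simp only [measureReal_def]
    rw [← fst_prod_restrict f hE, fst_prod_restrict_univ, Measure.restrict_apply_univ]
  rw [hmass, add_sub_cancel_right, integral_congr_ae (hac'.ae_le hllr)] at h
  exact h

/-- **The velocity relative entropy of the conditioned law.** For a measurable set of fibres `E` of positive mass
`m = f(E × ℝ³)`, the conditioned law `f' = m⁻¹ f|_{E×ℝ³}` has `velKL f' < ∞` and `m · velKL f' ≤ velKL f`. -/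
theorem velKL_cond_le (hE : MeasurableSet E) (hvk : velKL f ≠ ⊤) (hm : f (E ×ˢ Set.univ) ≠ 0) :
    velKL ((f (E ×ˢ (Set.univ : Set V3)))⁻¹ • f.restrict (E ×ˢ Set.univ)) ≠ ⊤ ∧
      (f (E ×ˢ (Set.univ : Set V3))).toReal *
          (velKL ((f (E ×ˢ (Set.univ : Set V3)))⁻¹ • f.restrict (E ×ˢ Set.univ))).toReal ≤
        (velKL f).toReal := by
  set S : Set (T3 × V3) := E ×ˢ Set.univ with hSdef
  set μ : Measure (T3 × V3) := f.fst.prod (stdGaussian V3) with hμ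
  have hS : MeasurableSet S := hE.prod MeasurableSet.univ
  have hmtop : f S ≠ ⊤ := measure_ne_top f S
  set cE : ℝ≥0∞ := (f S)⁻¹ with hcE
  have hcEtop : cE ≠ ⊤ := ENNReal.inv_ne_top.2 hm
  set cN : ℝ≥0 := cE.toNNReal with hcN
  have hcNE : (cN : ℝ≥0∞) = cE := ENNReal.coe_toNNReal hcEtop
  obtain ⟨hac, hint⟩ := klDiv_ne_top_iff.1 hvk
  -- the reference of the conditioned law is the conditioned reference
  have href : (cE • f.restrict S).fst.prod (stdGaussian V3) = cE • μ.restrict S := by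
    rw [hμ, ← fst_prod_restrict f hE]
    ext A hA
    rw [Measure.prod_apply hA, Measure.smul_apply, Measure.prod_apply hA, Measure.fst, Measure.fst,
      Measure.map_smul, lintegral_smul_measure, smul_eq_mul]
  -- KL of the conditioned law = cE × KL of the restriction
  have hkl : velKL (cE • f.restrict S) = cE * klDiv (f.restrict S) (μ.restrict S) := by
    unfold velKL
    rw [href, ← hcNE, ← nnreal_smul_eq_coe_smul, ← nnreal_smul_eq_coe_smul, klDiv_smul_same]
  -- KL of the restriction: finite, and equal to `∫_S llr f μ df`
  have hac' : f.restrict S ≪ μ.restrict S := hac.restrict _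
  have hllr := llr_restrict_ae_eq f hS hac
  have hint' : Integrable (llr (f.restrict S) (μ.restrict S)) (f.restrict S) :=
    (integrable_congr (hac'.ae_le hllr)).2 hint.integrableOn
  have hfin : klDiv (f.restrict S) (μ.restrict S) ≠ ⊤ := klDiv_ne_top_iff.2 ⟨hac', hint'⟩
  have hmassS : (f.restrict S) Set.univ = (μ.restrict S) Set.univ := by
    rw [Measure.restrict_apply_univ, hμ, ← fst_prod_restrict f hE, fst_prod_restrict_univ]
  have hval : (klDiv (f.restrict S) (μ.restrict S)).toReal = ∫ y in S, llr f μ y ∂f := by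
    rw [toReal_klDiv_of_measure_eq hac' hmassS, integral_congr_ae (hac'.ae_le hllr)]
  refine ⟨?_, ?_⟩
  · rw [hkl]
    exact ENNReal.mul_ne_top hcEtop hfin
  · rw [hkl, ENNReal.toReal_mul, hval, hcE, ENNReal.toReal_inv, ← mul_assoc,
      mul_inv_cancel₀ (ENNReal.toReal_ne_zero.2 ⟨hm, hmtop⟩), one_mul]
    have hsplit := integral_add_compl hS hint
    have hnn : 0 ≤ ∫ y in Sᶜ, llr f μ y ∂f := by
      have h := setIntegral_llr_nonneg (f := f) hE.compl hvk
      have hSc : (Eᶜ ×ˢ (Set.univ : Set V3)) = Sᶜ := by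
        rw [hSdef, Set.compl_prod_eq_union, Set.compl_univ, Set.prod_empty, Set.union_empty]
      rwa [hSc] at h
    calc ∫ y in S, llr f μ y ∂f ≤ ∫ y, llr f μ y ∂f := by linarith
      _ = (velKL f).toReal := by
          unfold velKL
          rw [toReal_klDiv_of_measure_eq hac (by rw [measure_univ, measure_univ])]

/-- **Density of the conditioned law**: `d f'/d m = f(S)⁻¹ · 1_S · d f/d m` a.e. (`m = vol ⊗ γ`). -/
theorem toReal_rnDeriv_cond_ae_eq (hE : MeasurableSet E) (hm : f (E ×ˢ Set.univ) ≠ 0) :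
    (fun y => (((f (E ×ˢ (Set.univ : Set V3)))⁻¹ • f.restrict (E ×ˢ Set.univ)).rnDeriv refMeasure y).toReal)
      =ᵐ[refMeasure] fun y => (f (E ×ˢ (Set.univ : Set V3)))⁻¹.toReal *
        Set.indicator (E ×ˢ Set.univ) (fun y => (f.rnDeriv refMeasure y).toReal) y := by
  have hS : MeasurableSet (E ×ˢ (Set.univ : Set V3)) := hE.prod MeasurableSet.univ
  haveI : SigmaFinite refMeasure := by
    change SigmaFinite ((volume : Measure T3).prod (stdGaussian V3)); infer_instance
  set cE : ℝ≥0∞ := (f (E ×ˢ (Set.univ : Set V3)))⁻¹ with hcE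
  have hcEtop : cE ≠ ⊤ := ENNReal.inv_ne_top.2 hm
  set cN : ℝ≥0 := cE.toNNReal with hcN
  have hcNE : (cN : ℝ≥0∞) = cE := ENNReal.coe_toNNReal hcEtop
  have h1 : (cE • f.restrict (E ×ˢ Set.univ)).rnDeriv refMeasure =ᵐ[refMeasure]
      cN • (f.restrict (E ×ˢ Set.univ)).rnDeriv refMeasure := by
    rw [← hcNE, ← nnreal_smul_eq_coe_smul]
    exact Measure.rnDeriv_smul_left _ _ cN
  have h2 := Measure.rnDeriv_restrict f refMeasure hS
  filter_upwards [h1, h2] with y hy1 hy2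
  simp only [hy1, Pi.smul_apply, hy2, ENNReal.smul_def, smul_eq_mul, ENNReal.toReal_mul, hcNE]
  congr 1
  by_cases hy : y ∈ E ×ˢ (Set.univ : Set V3)
  · simp [Set.indicator_of_mem hy]
  · simp [Set.indicator_of_notMem hy]

end Condition

end Localise

/-- **Localisation**: the gain–dissipation duality collected on a measurable set of fibres follows from the global
form by conditioning on `E × ℝ³` (restriction–renormalisation). -/
theorem gainDominationLocal_of_gainDomination (hGD : GainDomination) : GainDominationLocal := by
  obtain ⟨κ₁, hκ₁, hG⟩ := hGD
  refine ⟨κ₁, hκ₁, fun g hg hgκ horth => ?_⟩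
  obtain ⟨C, hC0, hC⟩ := hG g hg hgκ horth
  refine ⟨C, hC0, fun φ hφm hφ1 E hE f hfP hfac hvk d hd0 hprod => ?_⟩
  have hS : MeasurableSet (E ×ˢ (Set.univ : Set V3)) := hE.prod MeasurableSet.univ
  haveI : SigmaFinite refMeasure := by
    change SigmaFinite ((volume : Measure T3).prod (stdGaussian V3)); infer_instance
  -- the cut gain is the gain of the restriction
  have hind : ∀ y : T3 × V3, Set.indicator E φ y.1 * g y.2 =
      Set.indicator (E ×ˢ Set.univ) (fun y => φ y.1 * g y.2) y := by
    intro y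
    by_cases hy : y.1 ∈ E
    · rw [Set.indicator_of_mem hy, Set.indicator_of_mem (show y ∈ E ×ˢ (Set.univ : Set V3) from ⟨hy, trivial⟩)]
    · rw [Set.indicator_of_notMem hy, Set.indicator_of_notMem (fun h : y ∈ E ×ˢ (Set.univ : Set V3) => hy h.1),
        zero_mul]
  have hgain : ∫ y, Set.indicator E φ y.1 * g y.2 ∂f = ∫ y in E ×ˢ Set.univ, φ y.1 * g y.2 ∂f := by
    simp_rw [hind]
    exact integral_indicator hS
  have hRHS0 : 0 ≤ C * Real.sqrt d + 2⁻¹ * (velKL f).toReal := by positivity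
  by_cases hm : f (E ×ˢ Set.univ) = 0
  · -- no mass on the fibres over `E`: the cut gain vanishes
    rw [hgain, Measure.restrict_eq_zero.2 hm, integral_zero_measure]
    exact hRHS0
  -- condition on the fibres over `E`
  set S : Set (T3 × V3) := E ×ˢ Set.univ with hSdef
  set cE : ℝ≥0∞ := (f S)⁻¹ with hcE
  have hmtop : f S ≠ ⊤ := measure_ne_top f S
  have hcEtop : cE ≠ ⊤ := ENNReal.inv_ne_top.2 hm
  set f' : Measure (T3 × V3) := cE • f.restrict S with hf'
  have hf'P : IsProbabilityMeasure f' :=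
    ⟨by rw [hf', Measure.smul_apply, Measure.restrict_apply_univ, hcE, smul_eq_mul,
      ENNReal.inv_mul_cancel hm hmtop]⟩
  have hf'ac : f' ≪ refMeasure :=
    ((Measure.absolutelyContinuous_of_le Measure.restrict_le_self).trans hfac).smul_left cE
  obtain ⟨hvk', hvkle⟩ := Localise.velKL_cond_le (f := f) hE hvk hm
  -- production of the conditioned density
  set m : ℝ := (f S).toReal with hmR
  have hm0 : 0 < m := ENNReal.toReal_pos hm hmtop
  have hcEre : cE.toReal = m⁻¹ := by rw [hcE, ENNReal.toReal_inv]
  have hprod' : production (fun y => (f'.rnDeriv refMeasure y).toReal) ≤ ENNReal.ofReal (m⁻¹ ^ 2 * d) := by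
    rw [Localise.production_congr_ae (Localise.toReal_rnDeriv_cond_ae_eq (f := f) hE hm), hcEre,
      Localise.production_const_mul (inv_nonneg.2 hm0.le), ENNReal.ofReal_mul (sq_nonneg _)]
    gcongr
  -- the global lemma for the conditioned law
  have hglob := hC φ hφm hφ1 f' hf'P hf'ac hvk' (m⁻¹ ^ 2 * d) (by positivity) hprod'
  -- back to `f`: the gain scales by `m`, the production by `m²`, the entropy by at most `m`
  have hgain' : ∫ y, Set.indicator E φ y.1 * g y.2 ∂f = m * ∫ y, φ y.1 * g y.2 ∂f' := by
    rw [hgain, hf', integral_smul_measure, hcEre, smul_eq_mul, ← mul_assoc, mul_inv_cancel₀ hm0.ne', one_mul]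
  have hsqrt : Real.sqrt (m⁻¹ ^ 2 * d) = m⁻¹ * Real.sqrt d := by
    rw [Real.sqrt_mul (sq_nonneg _), Real.sqrt_sq (inv_nonneg.2 hm0.le)]
  rw [hsqrt] at hglob
  rw [hgain']
  calc m * ∫ y, φ y.1 * g y.2 ∂f' ≤ m * (C * (m⁻¹ * Real.sqrt d) + 2⁻¹ * (velKL f').toReal) :=
        mul_le_mul_of_nonneg_left hglob hm0.le
    _ = C * Real.sqrt d + 2⁻¹ * (m * (velKL f').toReal) := by
        field_simp
    _ ≤ C * Real.sqrt d + 2⁻¹ * (velKL f).toReal := by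
        have : m * (velKL f').toReal ≤ (velKL f).toReal := hvkle
        linarith


/-- **Registered stub S4'** (`stub_gainDominationLocal`), from the landed global form `stub_gainDomination` (p140248). -/
theorem stub_gainDominationLocal : GainDominationLocal :=
  gainDominationLocal_of_gainDomination stub_gainDomination

end Summit.AtomisticToContinuum.HydrodynamicLimit.Theorems.HTheorem

end
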